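import Summits.HodgeConjecture.HodgeConjecture.Theorems.F0P3cStCharTSEllMassHOrbEll     -- ★ (B2a) p852595 (this seat): product levels `C⋆`, compactness bookkeeping; brings ★ FixedPointsVolume ∕ Pair ∕ GRegularLocalisation
import Literature.NumberTheory.Automorphic.OrbitalIntegralFixedPointsPerPeriodTorus      -- ★ (S4a) per-period engine `classOrbitalIntegral_indicator_complex_eq_mul_natCard_quotient_zpowers`
import Literature.NumberTheory.Automorphic.CompactCoreCentralizerUnitary                 -- ★ `centralizer_prod_singleton`, `isCompact_∕isOpen_compactCore_centralizer_prod`, `mul_comm_centralizer_prod`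
import Literature.NumberTheory.Automorphic.OrbitalMeasureCanonicalExistsCM               -- ★ `compactCore_centralizer_local_facts_of_isRegularElt`; brings ★ `compactCore_prod`, `image_compactCore`
import Literature.NumberTheory.Automorphic.UnitaryGroupSplitTorusRankOne                 -- ★ (S4c) `exists_splitTorus_generator_local_of_nonsplit`
import Literature.NumberTheory.Automorphic.UnitaryRankTwoRegularTorusTrichotomy           -- ★ (g-D) `exists_conj_val_eq_glDiagonal_of_not_compactSpace_centralizer`
import Literature.NumberTheory.Rogawski1990.UnitaryTwoTypeTwoEdgeCount                   -- ★ `placeForm_antidiagTwo_eq_antidiag` (the one-place form of `Φ₂`)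
import Literature.NumberTheory.GaloisRepresentations.HeckeCharacter                      -- ★ `HeckeCharacter.valued_uniformizer`
import Literature.NumberTheory.Automorphic.ValuedFieldValuativeRelBridge                 -- ★ `isUniformizingElement_of_v_eq`, `isDiscreteValuationRing_integer_of_compatible`
import Literature.MeasureTheory.Group.InvariantQuotientProd                              -- ★ `prodEquiv_smul` (equivariance of Mathlib `QuotientGroup.prodEquiv`)
import HarnessLib

/-!
# F0 · P3c · line LH6 «StCharTS» — road «M5-H» (LEAD T14-41), brick (B2b) «H-ORB-SPLIT»: at a `G`-regular class of `H_v = U(Φ₂)(L⁺_v) × U(Φ₁)(L⁺_v)` with NON-compact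
# centraliser, the volume-normalised orbital integral of a product level `C × U(Φ₁)(L⁺_v)` equals the `U(Φ₂)(L⁺_v)`-side one of `𝟙_C` — both are Kottwitz's per-period
# fixed-point count on `U(Φ₂)(L⁺_v) ⧸ C` [Kottwitz1988, §2 Thm. 2 (non-elliptic case); Laumon1996, (5.3.2); Serre, *Trees* II.1; Rogawski1990, §4.9 p. 54]

Cell `pub/hodgecm-mathlib`, crux H413 = `stmt-HodgeConjecture-24833` (lane `--supports … --as helper`), route HCCMUnconditional; seat F0P3a-p04 (g29), ROAD «M5-H» holder
(LEAD T14-41 fences (α)–(ε); census `F0/P3a/F0P3a-p04/g29/m5h/CENSUS-M5H.v1`).  THEOREMS ONLY (no definition ∕ instance ∕ notation ∕ named fact ∕ `sorry`); ★-only imports.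

WHY.  With ★ (B2a) (compact centralisers) this file completes the `H`-side instance of Kottwitz's Euler–Poincaré computation WITHOUT a tree on `H_v` and without an Iwasawa
transport (fence (β): a new brick, read off the ★ `U₂`-currency): for `C ≤ U₂ = U(Φ₂)(L⁺_v)` compact open, `C⋆ := C.prod ⊤`, ANY Haar measures `νHv`, `ν₂` and canonical families
`mHv` (for `IsLocalGRegular`, `νHv`), `m₂` (for `IsRegularElt`, `ν₂`), at a `G`-regular `γ_H` whose `U₂`-centraliser is NOT compact,
  `Φ_H(⟦γ_H⟧, νHv(C⋆)⁻¹ · 𝟙_{C⋆}; mHv) = Φ_{U₂}(⟦γ_H.1⟧, ν₂(C)⁻¹ · 𝟙_C; m₂)`.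
Road: conjugate `γ_H.1` to a regular diagonal `δ` (★ (g-D)); ★ (S4c) gives the split-torus generator `τ ∈ Z_{U₂}(δ)` with (gen)∕(free) modulo the compact core; on
`H_v`, `Z_H((δ, u)) = Z_{U₂}(δ) × Z_{U₁}(u)` (★ `centralizer_prod_singleton`) has compact open compact core (★ §1 (s2) of `CompactCoreCentralizerUnitary`, ★ `compactCore_prod`)
and `τ_H := (τ, 1)` satisfies (gen)∕(free) there (§2); the ★ per-period engine (S4a) then reads BOTH volume-normalised orbital integrals as `#(Fix ⧸ τ^ℤ)` — on
`H_v ⧸ C⋆` and on `U₂ ⧸ C` — and these two counts agree by the generic §1 (`(A × B) ⧸ (K_A × B) ≃ A ⧸ K_A`, equivariantly).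

* §1 GENERIC (groups `A, B`, `K_A ≤ A`, `τ_A ∈ Z_A(a)`, `τ = (τ_A, 1) ∈ Z_{A×B}((a, b))`): `natCard_quotient_orbitRel_zpowers_fixedBy_prod_top` — the per-period fixed-point counts on
  `(A × B) ⧸ (K_A.prod ⊤)` and on `A ⧸ K_A` coincide.
* §2 `H_v`: `classOrbitalIntegral_smul_indicator_prod_top_eq_U2_of_not_compactSpace` — the displayed identity; with ★ (B2a)'s elliptic twin,
  `classOrbitalIntegral_smul_indicator_prod_top_eq_U2_of_isLocalGRegular` — the identity at EVERY `G`-regular class.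
HONEST LABEL: count-neutral helper of «M5-H»; (M5) stays a PRINTED block consequent until its ★ rider; HC_CM is proved only modulo the 7 printed citations (2 remaining named inputs:
hLiu418 = `stmt-HodgeConjecture-24832`, h413 = `stmt-HodgeConjecture-24833`) until rung 0 closes.

## References
* [Kottwitz1988] R. E. Kottwitz, *Tamagawa numbers*, Ann. of Math. 127 (1988), 629–646, §2 Theorem 2.
* [Laumon1995] G. Laumon, *Cohomology of Drinfeld Modular Varieties* I (1996), Lemma (5.3.2) p. 136.
* [Serre1980Trees] J.-P. Serre, *Trees* (1980), II.1.1–1.3.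
* [Rogawski1990] J. D. Rogawski, *Automorphic Representations of Unitary Groups in Three Variables*, Ann. of Math. Stud. 123 (1990): §3.6 pp. 31–32; §4.3 (4.3.1) p. 43;
  §4.9 p. 54; §12.5 p. 184; §12.6 p. 187.
-/

set_option autoImplicit false
-- the mandated namespace has the single-problem summit's repeated segment (`HodgeConjecture.HodgeConjecture`)
set_option linter.dupNamespace false

noncomputable section

open NumberField IsDedekindDomain MeasureTheory Measure Topology Set Matrix
open scoped Matrix MatrixGroups ENNReal ValuativeRel
open Literature.NumberTheory.Rogawski1990 Literature.NumberTheory.Automorphic Literature.NumberTheory.Automorphic.UnitaryGroup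
open Literature.NumberTheory.GaloisRepresentations

namespace Summit.HodgeConjecture.HodgeConjecture.Cruxes.H413.F0P3cStCharTSEllMassHOrbSplit

/-! ## §1 Generic: per-period fixed-point counts on `(A × B) ⧸ (K_A × B)` and on `A ⧸ K_A` -/

section Generic

variable {A B : Type*} [Group A] [Group B]

/-- **Per-period counts on a product with a trivial second level.**  For `K_A ≤ A`, `(a, b) ∈ A × B`, `τ_A ∈ Z_A(a)` and `τ ∈ Z_{A×B}((a,b))` with `τ = (τ_A, 1)`:
the number of `τ^ℤ`-orbits on `Fix_{(a,b)}((A × B) ⧸ (K_A × B))` is the number of `τ_A^ℤ`-orbits on `Fix_a(A ⧸ K_A)` — along the first coordinate of Mathlib's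
`QuotientGroup.prodEquiv` (equivariant, ★ `prodEquiv_smul`; the second factor `B ⧸ B` is one point). [cite: Serre1980Trees, II.1.1] [cite: Kottwitz1988, §2] -/
theorem natCard_quotient_orbitRel_zpowers_fixedBy_prod_top (KA : Subgroup A) (a : A) (b : B)
    (τA : Subgroup.centralizer ({a} : Set A)) (τ : Subgroup.centralizer ({(a, b)} : Set (A × B)))
    (hτ : ((τ : A × B)) = ((τA : A), (1 : B))) :
    Nat.card (Quotient ((MulAction.orbitRel (Subgroup.zpowers τ) ((A × B) ⧸ KA.prod (⊤ : Subgroup B))).comap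
        (Subtype.val : MulAction.fixedBy ((A × B) ⧸ KA.prod (⊤ : Subgroup B)) (a, b) → (A × B) ⧸ KA.prod (⊤ : Subgroup B)))) =
      Nat.card (Quotient ((MulAction.orbitRel (Subgroup.zpowers τA) (A ⧸ KA)).comap (Subtype.val : MulAction.fixedBy (A ⧸ KA) a → A ⧸ KA))) := by
  -- the first-coordinate reading `φ` of the product coset space, equivariant and bijective
  let φ : (A × B) ⧸ KA.prod (⊤ : Subgroup B) → A ⧸ KA := fun x => (QuotientGroup.prodEquiv KA ⊤ x).1
  have hφ : ∀ (g : A × B) (x : (A × B) ⧸ KA.prod (⊤ : Subgroup B)), φ (g • x) = g.1 • φ x := fun g x => by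
    show (QuotientGroup.prodEquiv KA ⊤ (g • x)).1 = g.1 • (QuotientGroup.prodEquiv KA ⊤ x).1
    rw [Literature.MeasureTheory.Group.prodEquiv_smul]
  haveI : Subsingleton (B ⧸ (⊤ : Subgroup B)) := QuotientGroup.subsingleton_quotient_top
  have hφinj : Function.Injective φ := fun x y hxy => by
    apply (QuotientGroup.prodEquiv KA ⊤).injective
    exact Prod.ext hxy (Subsingleton.elim _ _)
  have hφsurj : Function.Surjective φ := fun y => by
    refine ⟨(QuotientGroup.prodEquiv KA ⊤).symm (y, QuotientGroup.mk 1), ?_⟩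
    show (QuotientGroup.prodEquiv KA ⊤ ((QuotientGroup.prodEquiv KA ⊤).symm (y, QuotientGroup.mk 1))).1 = y
    rw [Equiv.apply_symm_apply]
  -- restriction to the fixed points
  let e : MulAction.fixedBy ((A × B) ⧸ KA.prod (⊤ : Subgroup B)) (a, b) ≃ MulAction.fixedBy (A ⧸ KA) a :=
    Equiv.ofBijective (fun x => ⟨φ x.1, by
        have h : φ ((a, b) • x.1) = φ x.1 := congrArg φ x.2
        rwa [hφ] at h⟩)
      ⟨fun x y hxy => Subtype.ext (hφinj (congrArg Subtype.val hxy)), fun y => by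
        obtain ⟨x, hx⟩ := hφsurj y.1
        refine ⟨⟨x, ?_⟩, Subtype.ext hx⟩
        show (a, b) • x = x
        apply hφinj
        rw [hφ, hx]
        exact y.2⟩
  have he : ∀ x : MulAction.fixedBy ((A × B) ⧸ KA.prod (⊤ : Subgroup B)) (a, b), ((e x : MulAction.fixedBy (A ⧸ KA) a) : A ⧸ KA) = φ x.1 := fun _ => rfl
  -- powers of `τ = (τ_A, 1)` read on the first coordinate
  have hτn : ∀ n : ℤ, ((τ ^ n : Subgroup.centralizer ({(a, b)} : Set (A × B))) : A × B).1 = ((τA ^ n : Subgroup.centralizer ({a} : Set A)) : A) := fun n => by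
    rw [Subgroup.coe_zpow, Subgroup.coe_zpow, hτ]; rfl
  -- the orbit relations correspond
  refine Nat.card_congr (Quotient.congr e fun x y => ?_)
  show (x : (A × B) ⧸ KA.prod (⊤ : Subgroup B)) ∈ MulAction.orbit (Subgroup.zpowers τ) (y : (A × B) ⧸ KA.prod (⊤ : Subgroup B)) ↔
    ((e x : MulAction.fixedBy (A ⧸ KA) a) : A ⧸ KA) ∈ MulAction.orbit (Subgroup.zpowers τA) ((e y : MulAction.fixedBy (A ⧸ KA) a) : A ⧸ KA)
  rw [MulAction.mem_orbit_iff, MulAction.mem_orbit_iff, he, he]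
  constructor
  · rintro ⟨⟨g, hg⟩, hgy⟩
    obtain ⟨n, rfl⟩ := Subgroup.mem_zpowers_iff.1 hg
    refine ⟨⟨τA ^ n, Subgroup.mem_zpowers_iff.2 ⟨n, rfl⟩⟩, ?_⟩
    have h1 : ((⟨τ ^ n, hg⟩ : Subgroup.zpowers τ) • (y : (A × B) ⧸ KA.prod (⊤ : Subgroup B))) = ((τ ^ n : Subgroup.centralizer ({(a, b)} : Set (A × B))) : A × B) • (y : (A × B) ⧸ KA.prod (⊤ : Subgroup B)) := rfl
    have h2 : ((⟨τA ^ n, Subgroup.mem_zpowers_iff.2 ⟨n, rfl⟩⟩ : Subgroup.zpowers τA) • φ (y : (A × B) ⧸ KA.prod (⊤ : Subgroup B))) =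
        ((τA ^ n : Subgroup.centralizer ({a} : Set A)) : A) • φ (y : (A × B) ⧸ KA.prod (⊤ : Subgroup B)) := rfl
    rw [h2, ← hgy, h1, hφ, hτn]
  · rintro ⟨⟨g, hg⟩, hgy⟩
    obtain ⟨n, rfl⟩ := Subgroup.mem_zpowers_iff.1 hg
    refine ⟨⟨τ ^ n, Subgroup.mem_zpowers_iff.2 ⟨n, rfl⟩⟩, ?_⟩
    apply hφinj
    have h1 : ((⟨τ ^ n, Subgroup.mem_zpowers_iff.2 ⟨n, rfl⟩⟩ : Subgroup.zpowers τ) • (y : (A × B) ⧸ KA.prod (⊤ : Subgroup B))) =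
        ((τ ^ n : Subgroup.centralizer ({(a, b)} : Set (A × B))) : A × B) • (y : (A × B) ⧸ KA.prod (⊤ : Subgroup B)) := rfl
    have h2 : ((⟨τA ^ n, hg⟩ : Subgroup.zpowers τA) • φ (y : (A × B) ⧸ KA.prod (⊤ : Subgroup B))) =
        ((τA ^ n : Subgroup.centralizer ({a} : Set A)) : A) • φ (y : (A × B) ⧸ KA.prod (⊤ : Subgroup B)) := rfl
    rw [h1, hφ, hτn, ← h2, hgy]

end Generic

/-! ## §2 `H_v`: the volume-normalised orbital integral of a product level at a `G`-regular class with NON-compact centraliser -/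

section CM

variable (L : Type) [Field L] [NumberField L] [IsCMField L] (v : HeightOneSpectrum (𝓞 ↥(maximalRealSubfield L)))
  [MeasurableSpace (((UnitaryGroup.cmDatum L 2 (Matrix.of fun i j : Fin 2 => if i.val + j.val + 1 = 2 then (1 : L) else 0)).Local v) ×
      ((UnitaryGroup.cmDatum L 1 (Matrix.of fun i j : Fin 1 => if i.val + j.val + 1 = 1 then (1 : L) else 0)).Local v))] [BorelSpace (((UnitaryGroup.cmDatum L 2 (Matrix.of fun i j : Fin 2 => if i.val + j.val + 1 = 2 then (1 : L) else 0)).Local v) ×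
      ((UnitaryGroup.cmDatum L 1 (Matrix.of fun i j : Fin 1 => if i.val + j.val + 1 = 1 then (1 : L) else 0)).Local v))]
  [∀ a : (((UnitaryGroup.cmDatum L 2 (Matrix.of fun i j : Fin 2 => if i.val + j.val + 1 = 2 then (1 : L) else 0)).Local v) ×
      ((UnitaryGroup.cmDatum L 1 (Matrix.of fun i j : Fin 1 => if i.val + j.val + 1 = 1 then (1 : L) else 0)).Local v)), MeasurableSpace ((((UnitaryGroup.cmDatum L 2 (Matrix.of fun i j : Fin 2 => if i.val + j.val + 1 = 2 then (1 : L) else 0)).Local v) ×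
      ((UnitaryGroup.cmDatum L 1 (Matrix.of fun i j : Fin 1 => if i.val + j.val + 1 = 1 then (1 : L) else 0)).Local v)) ⧸ Subgroup.centralizer ({a} : Set (((UnitaryGroup.cmDatum L 2 (Matrix.of fun i j : Fin 2 => if i.val + j.val + 1 = 2 then (1 : L) else 0)).Local v) ×
      ((UnitaryGroup.cmDatum L 1 (Matrix.of fun i j : Fin 1 => if i.val + j.val + 1 = 1 then (1 : L) else 0)).Local v))))]
  [∀ a : (((UnitaryGroup.cmDatum L 2 (Matrix.of fun i j : Fin 2 => if i.val + j.val + 1 = 2 then (1 : L) else 0)).Local v) ×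
      ((UnitaryGroup.cmDatum L 1 (Matrix.of fun i j : Fin 1 => if i.val + j.val + 1 = 1 then (1 : L) else 0)).Local v)), BorelSpace ((((UnitaryGroup.cmDatum L 2 (Matrix.of fun i j : Fin 2 => if i.val + j.val + 1 = 2 then (1 : L) else 0)).Local v) ×
      ((UnitaryGroup.cmDatum L 1 (Matrix.of fun i j : Fin 1 => if i.val + j.val + 1 = 1 then (1 : L) else 0)).Local v)) ⧸ Subgroup.centralizer ({a} : Set (((UnitaryGroup.cmDatum L 2 (Matrix.of fun i j : Fin 2 => if i.val + j.val + 1 = 2 then (1 : L) else 0)).Local v) ×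
      ((UnitaryGroup.cmDatum L 1 (Matrix.of fun i j : Fin 1 => if i.val + j.val + 1 = 1 then (1 : L) else 0)).Local v))))]
  (νHv : Measure (((UnitaryGroup.cmDatum L 2 (Matrix.of fun i j : Fin 2 => if i.val + j.val + 1 = 2 then (1 : L) else 0)).Local v) ×
      ((UnitaryGroup.cmDatum L 1 (Matrix.of fun i j : Fin 1 => if i.val + j.val + 1 = 1 then (1 : L) else 0)).Local v))) [νHv.IsHaarMeasure] [νHv.IsMulRightInvariant]
  [MeasurableSpace ((UnitaryGroup.cmDatum L 2 (Matrix.of fun i j : Fin 2 => if i.val + j.val + 1 = 2 then (1 : L) else 0)).Local v)] [BorelSpace ((UnitaryGroup.cmDatum L 2 (Matrix.of fun i j : Fin 2 => if i.val + j.val + 1 = 2 then (1 : L) else 0)).Local v)]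
  [∀ γ : ((UnitaryGroup.cmDatum L 2 (Matrix.of fun i j : Fin 2 => if i.val + j.val + 1 = 2 then (1 : L) else 0)).Local v), MeasurableSpace (((UnitaryGroup.cmDatum L 2 (Matrix.of fun i j : Fin 2 => if i.val + j.val + 1 = 2 then (1 : L) else 0)).Local v) ⧸ Subgroup.centralizer ({γ} : Set ((UnitaryGroup.cmDatum L 2 (Matrix.of fun i j : Fin 2 => if i.val + j.val + 1 = 2 then (1 : L) else 0)).Local v)))]
  [∀ γ : ((UnitaryGroup.cmDatum L 2 (Matrix.of fun i j : Fin 2 => if i.val + j.val + 1 = 2 then (1 : L) else 0)).Local v), BorelSpace (((UnitaryGroup.cmDatum L 2 (Matrix.of fun i j : Fin 2 => if i.val + j.val + 1 = 2 then (1 : L) else 0)).Local v) ⧸ Subgroup.centralizer ({γ} : Set ((UnitaryGroup.cmDatum L 2 (Matrix.of fun i j : Fin 2 => if i.val + j.val + 1 = 2 then (1 : L) else 0)).Local v)))]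
  (ν₂ : Measure ((UnitaryGroup.cmDatum L 2 (Matrix.of fun i j : Fin 2 => if i.val + j.val + 1 = 2 then (1 : L) else 0)).Local v)) [ν₂.IsHaarMeasure] [ν₂.IsMulRightInvariant]

set_option maxHeartbeats 1600000 in
/-- **(N_H)-SIDE READING = `U₂`-SIDE READING.**  `v` non-split; `mHv` canonical for (`IsLocalGRegular`, `νHv`), `m₂` canonical for (`IsRegularElt`, `ν₂`); `C ≤ U₂` compact open,
`C⋆ = C.prod ⊤`; `γ_H` `G`-regular with `Z_{U₂}(γ_H.1)` NOT compact.  Then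
`Φ_H(⟦γ_H⟧, νHv(C⋆)⁻¹ · 𝟙_{C⋆}; mHv) = Φ_{U₂}(⟦γ_H.1⟧, ν₂(C)⁻¹ · 𝟙_C; m₂)` — both are the per-period count `#(Fix ⧸ τ^ℤ)` of ★ (S4a) for the split-torus generator `τ`
(★ (S4c)) at a diagonal representative (★ (g-D)), read on `H_v ⧸ C⋆` and on `U₂ ⧸ C` (§1).
[cite: Kottwitz1988, §2 Theorem 2] [cite: Laumon1995, Lemma (5.3.2) p. 136] [cite: Serre1980Trees, II.1.1–1.3] [cite: Rogawski1990, §3.6 pp. 31–32; §4.9 p. 54] -/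
theorem classOrbitalIntegral_smul_indicator_prod_top_eq_U2_of_not_compactSpace
    (hns : ∀ w : PlacesOver L v, IsCMField.complexConj L • w.1 = w.1)
    {mHv : OrbitalMeasureFamily (((UnitaryGroup.cmDatum L 2 (Matrix.of fun i j : Fin 2 => if i.val + j.val + 1 = 2 then (1 : L) else 0)).Local v) ×
      ((UnitaryGroup.cmDatum L 1 (Matrix.of fun i j : Fin 1 => if i.val + j.val + 1 = 1 then (1 : L) else 0)).Local v))} (hcanH : mHv.IsCanonical (IsLocalGRegular L v) νHv)
    {m₂ : OrbitalMeasureFamily ((UnitaryGroup.cmDatum L 2 (Matrix.of fun i j : Fin 2 => if i.val + j.val + 1 = 2 then (1 : L) else 0)).Local v)} (hcan₂ : m₂.IsCanonical (fun γ => IsRegularElt (γ.val : GL (Fin 2) (UnitaryGroup.LocalRing L v))) ν₂)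
    (C : Subgroup ((UnitaryGroup.cmDatum L 2 (Matrix.of fun i j : Fin 2 => if i.val + j.val + 1 = 2 then (1 : L) else 0)).Local v)) (hCo : IsOpen (C : Set ((UnitaryGroup.cmDatum L 2 (Matrix.of fun i j : Fin 2 => if i.val + j.val + 1 = 2 then (1 : L) else 0)).Local v))) (hCc : IsCompact (C : Set ((UnitaryGroup.cmDatum L 2 (Matrix.of fun i j : Fin 2 => if i.val + j.val + 1 = 2 then (1 : L) else 0)).Local v)))
    (γH : (((UnitaryGroup.cmDatum L 2 (Matrix.of fun i j : Fin 2 => if i.val + j.val + 1 = 2 then (1 : L) else 0)).Local v) ×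
      ((UnitaryGroup.cmDatum L 1 (Matrix.of fun i j : Fin 1 => if i.val + j.val + 1 = 1 then (1 : L) else 0)).Local v))) (hγ : IsLocalGRegular L v γH)
    (hnc : ¬ CompactSpace (Subgroup.centralizer ({γH.1} : Set ((UnitaryGroup.cmDatum L 2 (Matrix.of fun i j : Fin 2 => if i.val + j.val + 1 = 2 then (1 : L) else 0)).Local v)))) :
    classOrbitalIntegral mHv
        (fun g => (((νHv ((C.prod ⊤ : Subgroup (((UnitaryGroup.cmDatum L 2 (Matrix.of fun i j : Fin 2 => if i.val + j.val + 1 = 2 then (1 : L) else 0)).Local v) ×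
      ((UnitaryGroup.cmDatum L 1 (Matrix.of fun i j : Fin 1 => if i.val + j.val + 1 = 1 then (1 : L) else 0)).Local v))))).toReal : ℂ))⁻¹ * (((C.prod ⊤ : Subgroup (((UnitaryGroup.cmDatum L 2 (Matrix.of fun i j : Fin 2 => if i.val + j.val + 1 = 2 then (1 : L) else 0)).Local v) ×
      ((UnitaryGroup.cmDatum L 1 (Matrix.of fun i j : Fin 1 => if i.val + j.val + 1 = 1 then (1 : L) else 0)).Local v)))) : Set _).indicator (fun _ => (1 : ℂ)) g)
        (ConjClasses.mk γH) =
      classOrbitalIntegral m₂ (fun g => (((ν₂ C).toReal : ℂ))⁻¹ * (C : Set ((UnitaryGroup.cmDatum L 2 (Matrix.of fun i j : Fin 2 => if i.val + j.val + 1 = 2 then (1 : L) else 0)).Local v)).indicator (fun _ => (1 : ℂ)) g) (ConjClasses.mk γH.1) := by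
  obtain ⟨w⟩ : Nonempty (PlacesOver L v) := inferInstance
  have hw : IsCMField.complexConj L • w.1 = w.1 := hns w
  haveI : Algebra.IsQuadraticExtension ↥(maximalRealSubfield L) L := IsCMField.isQuadraticExtension L
  haveI hvs : Subsingleton (PlacesOver L v) := PlacesOver.subsingleton_of_smul_eq (IsCMField.complexConj L) (IsCMField.complexConj_ne_one L) w hw
  have hc1 : IsCMField.complexConj L ≠ 1 := IsCMField.complexConj_ne_one L
  -- one-place data at `w`
  set E := w.1.adicCompletion L with hEdef
  set σ : E →+* E := galAdicCompletionMap (L := L) (IsCMField.complexConj L) hw with hσdef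
  set eW := (localNonsplitEquiv (IsCMField.complexConj L) (Matrix.of fun i j : Fin 2 => if i.val + j.val + 1 = 2 then (1 : L) else 0) hc1 w hw) with heW
  obtain ⟨η, hη⟩ : ∃ η : (w.1.adicCompletion L)ˣ, Valued.v (η : w.1.adicCompletion L) = WithZero.exp (-1 : ℤ) :=
    ⟨_, HeckeCharacter.valued_uniformizer (K := L) (v := w.1)⟩
  haveI : IsDiscreteValuationRing 𝒪[E] := isDiscreteValuationRing_integer_of_compatible hη
  have hϖ' : IsUniformizingElement ((η : w.1.adicCompletion L) : E) := isUniformizingElement_of_v_eq hη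
  -- class functions: `G`-regularity on `H_v`, regularity on `U₂`
  have hPH : ∀ g x : (((UnitaryGroup.cmDatum L 2 (Matrix.of fun i j : Fin 2 => if i.val + j.val + 1 = 2 then (1 : L) else 0)).Local v) ×
      ((UnitaryGroup.cmDatum L 1 (Matrix.of fun i j : Fin 1 => if i.val + j.val + 1 = 1 then (1 : L) else 0)).Local v)), IsLocalGRegular L v g → IsLocalGRegular L v (x * g * x⁻¹) := fun _ x hg => isLocalGRegular_of_isConj (isConj_iff.2 ⟨x, rfl⟩) hg
  have hP₂ : ∀ g x : ((UnitaryGroup.cmDatum L 2 (Matrix.of fun i j : Fin 2 => if i.val + j.val + 1 = 2 then (1 : L) else 0)).Local v), IsRegularElt (g.val : GL (Fin 2) (UnitaryGroup.LocalRing L v)) → IsRegularElt ((x * g * x⁻¹).val : GL (Fin 2) (UnitaryGroup.LocalRing L v)) :=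
    fun g x hg => isRegularElt_val_conj L 2 _ v g x hg
  have hreg := isRegularElt_fst_snd_of_isLocalGRegular L v γH hγ
  -- (g-D): a regular DIAGONAL representative `δ` of the class of `γ_H.1`, and `δH := (δ, γ_H.2)` of the class of `γ_H`
  obtain ⟨g, dv, hd, h01', -⟩ := exists_conj_val_eq_glDiagonal_of_not_compactSpace_centralizer L v w hw γH.1 hreg.1 hnc
  set δ : ((UnitaryGroup.cmDatum L 2 (Matrix.of fun i j : Fin 2 => if i.val + j.val + 1 = 2 then (1 : L) else 0)).Local v) := g * γH.1 * g⁻¹ with hδdef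
  have hregδ : IsRegularElt (δ.val : GL (Fin 2) (UnitaryGroup.LocalRing L v)) := isRegularElt_val_conj L 2 _ v γH.1 g hreg.1
  set δH : (((UnitaryGroup.cmDatum L 2 (Matrix.of fun i j : Fin 2 => if i.val + j.val + 1 = 2 then (1 : L) else 0)).Local v) ×
      ((UnitaryGroup.cmDatum L 1 (Matrix.of fun i j : Fin 1 => if i.val + j.val + 1 = 1 then (1 : L) else 0)).Local v)) := (δ, γH.2) with hδHdef
  have hconjH : ((g, (1 : ((UnitaryGroup.cmDatum L 1 (Matrix.of fun i j : Fin 1 => if i.val + j.val + 1 = 1 then (1 : L) else 0)).Local v))) : (((UnitaryGroup.cmDatum L 2 (Matrix.of fun i j : Fin 2 => if i.val + j.val + 1 = 2 then (1 : L) else 0)).Local v) ×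
      ((UnitaryGroup.cmDatum L 1 (Matrix.of fun i j : Fin 1 => if i.val + j.val + 1 = 1 then (1 : L) else 0)).Local v))) * γH * ((g, (1 : ((UnitaryGroup.cmDatum L 1 (Matrix.of fun i j : Fin 1 => if i.val + j.val + 1 = 1 then (1 : L) else 0)).Local v))) : (((UnitaryGroup.cmDatum L 2 (Matrix.of fun i j : Fin 2 => if i.val + j.val + 1 = 2 then (1 : L) else 0)).Local v) ×
      ((UnitaryGroup.cmDatum L 1 (Matrix.of fun i j : Fin 1 => if i.val + j.val + 1 = 1 then (1 : L) else 0)).Local v)))⁻¹ = δH := by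
    rw [hδHdef, hδdef]; exact Prod.ext rfl (by simp)
  have hδH : IsLocalGRegular L v δH := hconjH ▸ hPH γH (g, 1) hγ
  have hcl₂ : ConjClasses.mk δ = ConjClasses.mk γH.1 := ConjClasses.mk_eq_mk_iff_isConj.2 (isConj_iff.2 ⟨g, rfl⟩).symm
  have hclH : ConjClasses.mk δH = ConjClasses.mk γH := ConjClasses.mk_eq_mk_iff_isConj.2 (isConj_iff.2 ⟨(g, 1), hconjH⟩).symm
  rw [← hcl₂, ← hclH]
  -- the one-place matrix of `δ` is diagonal with distinct entries
  set d' : Fin 2 → E := fun i => ((dv i : UnitaryGroup.LocalRing L v)) w with hd'def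
  have hδφ : (((eW δ : ↥(unitaryGroupOfForm (galAdicCompletionMap (L := L) (IsCMField.complexConj L) hw)
      (placeForm (Matrix.of fun i j : Fin 2 => if i.val + j.val + 1 = 2 then (1 : L) else 0) w.1))) : GL (Fin 2) E) : Matrix (Fin 2) (Fin 2) E) = diagonal d' := by
    change ((δ.val : GL (Fin 2) (UnitaryGroup.LocalRing L v)) : Matrix (Fin 2) (Fin 2) (UnitaryGroup.LocalRing L v)).map
      (Pi.evalRingHom (fun w' : PlacesOver L v => w'.1.adicCompletion L) w) = diagonal d'
    rw [← hd, coe_glDiagonal, diagonal_map (map_zero _)]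
    rfl
  have hd01 : d' 0 ≠ d' 1 := by
    intro hEq
    apply h01'
    apply Units.ext
    funext w'
    obtain rfl : w' = w := Subsingleton.elim w' w
    exact hEq
  have hdist : ∀ i j : Fin 2, i ≠ j → IsUnit (d' i - d' j) := by
    intro i j hij
    rw [isUnit_iff_ne_zero, sub_ne_zero]
    fin_cases i <;> fin_cases j
    · exact absurd rfl hij
    · exact hd01
    · exact fun h => hd01 h.symm
    · exact absurd rfl hij
  -- the split-torus generator `τ₂ ∈ Z(δ)` with (gen)∕(free) (★ (S4c))
  have hH := placeForm_antidiagTwo_eq_antidiag L v w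
  have hJ00 : placeForm (Matrix.of fun i j : Fin 2 => if i.val + j.val + 1 = 2 then (1 : L) else 0) w.1 0 0 = 0 := by rw [hH]; rfl
  have hJ11 : placeForm (Matrix.of fun i j : Fin 2 => if i.val + j.val + 1 = 2 then (1 : L) else 0) w.1 1 1 = 0 := by rw [hH]; rfl
  have hJ01 : placeForm (Matrix.of fun i j : Fin 2 => if i.val + j.val + 1 = 2 then (1 : L) else 0) w.1 0 1 ≠ 0 := by rw [hH]; exact one_ne_zero
  obtain ⟨τ₂, -, hgen₂, hfree₂⟩ :
      ∃ τ : Subgroup.centralizer ({δ} : Set ((UnitaryGroup.cmDatum L 2 (Matrix.of fun i j : Fin 2 => if i.val + j.val + 1 = 2 then (1 : L) else 0)).Local v)),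
        (((eW (τ : ((UnitaryGroup.cmDatum L 2 (Matrix.of fun i j : Fin 2 => if i.val + j.val + 1 = 2 then (1 : L) else 0)).Local v)) : ↥(unitaryGroupOfForm (galAdicCompletionMap (L := L) (IsCMField.complexConj L) hw)
            (placeForm (Matrix.of fun i j : Fin 2 => if i.val + j.val + 1 = 2 then (1 : L) else 0) w.1))) : GL (Fin 2) E) : Matrix (Fin 2) (Fin 2) E) =
            diagonal ![((η : w.1.adicCompletion L) : E), (σ ((η : w.1.adicCompletion L) : E))⁻¹] ∧
        (∀ c' : Subgroup.centralizer ({δ} : Set ((UnitaryGroup.cmDatum L 2 (Matrix.of fun i j : Fin 2 => if i.val + j.val + 1 = 2 then (1 : L) else 0)).Local v)), ∃ n : ℤ, c' * (τ ^ n)⁻¹ ∈ compactCore (Subgroup.centralizer ({δ} : Set ((UnitaryGroup.cmDatum L 2 (Matrix.of fun i j : Fin 2 => if i.val + j.val + 1 = 2 then (1 : L) else 0)).Local v)))) ∧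
        (∀ n : ℤ, τ ^ n ∈ compactCore (Subgroup.centralizer ({δ} : Set ((UnitaryGroup.cmDatum L 2 (Matrix.of fun i j : Fin 2 => if i.val + j.val + 1 = 2 then (1 : L) else 0)).Local v))) → n = 0) :=
    exists_splitTorus_generator_local_of_nonsplit (IsCMField.complexConj L) (Matrix.of fun i j : Fin 2 => if i.val + j.val + 1 = 2 then (1 : L) else 0) hc1 w hw
      hJ00 hJ11 hJ01 hϖ' hδφ hdist
  -- compact-core facts on `U₂` and on `U₁`, closed classes
  obtain ⟨hcomm₂, hc₂, ho₂⟩ := compactCore_centralizer_local_facts_of_isRegularElt (IsCMField.complexConj L) 2 _ hc1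
    (UnitaryGroup.antidiagOne_map_transpose (IsCMField.complexConj L) 2) (isUnit_antidiagOne_det L 2) δ hregδ
  obtain ⟨hcomm₁, hc₁, ho₁⟩ := compactCore_centralizer_local_facts_of_isRegularElt (IsCMField.complexConj L) 1 _ hc1
    (UnitaryGroup.antidiagOne_map_transpose (IsCMField.complexConj L) 1) (isUnit_antidiagOne_det L 1) γH.2 hreg.2
  have hO₂ := isClosed_conjClass_local_of_isRegularElt L 2 (Matrix.of fun i j : Fin 2 => if i.val + j.val + 1 = 2 then (1 : L) else 0) v
    (antidiagOne_isHermitian L 2) (isUnit_antidiagOne_det L 2).ne_zero δ hregδ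
  have hOH := isClosed_conjClass_localH_of_isLocalGRegular L v δH hδH
  -- the `H_v`-side torus `Z_H(δH) = Z(δ) × Z(γ_H.2)`: commutative, compact open compact core, generator `τ_H = (τ₂, 1)`
  have hZH : Subgroup.centralizer ({δH} : Set (((UnitaryGroup.cmDatum L 2 (Matrix.of fun i j : Fin 2 => if i.val + j.val + 1 = 2 then (1 : L) else 0)).Local v) ×
      ((UnitaryGroup.cmDatum L 1 (Matrix.of fun i j : Fin 1 => if i.val + j.val + 1 = 1 then (1 : L) else 0)).Local v))) = (Subgroup.centralizer ({δ} : Set ((UnitaryGroup.cmDatum L 2 (Matrix.of fun i j : Fin 2 => if i.val + j.val + 1 = 2 then (1 : L) else 0)).Local v))).prod (Subgroup.centralizer ({γH.2} : Set ((UnitaryGroup.cmDatum L 1 (Matrix.of fun i j : Fin 1 => if i.val + j.val + 1 = 1 then (1 : L) else 0)).Local v))) :=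
    centralizer_prod_singleton δ γH.2
  have hcommH := mul_comm_centralizer_prod δ γH.2 hcomm₂ hcomm₁
  have hcH := isCompact_compactCore_centralizer_prod δ γH.2 hc₂ hc₁
  have hoH := isOpen_compactCore_centralizer_prod δ γH.2 ho₂ ho₁
  let τH : Subgroup.centralizer ({δH} : Set (((UnitaryGroup.cmDatum L 2 (Matrix.of fun i j : Fin 2 => if i.val + j.val + 1 = 2 then (1 : L) else 0)).Local v) ×
      ((UnitaryGroup.cmDatum L 1 (Matrix.of fun i j : Fin 1 => if i.val + j.val + 1 = 1 then (1 : L) else 0)).Local v))) := ⟨((τ₂ : ((UnitaryGroup.cmDatum L 2 (Matrix.of fun i j : Fin 2 => if i.val + j.val + 1 = 2 then (1 : L) else 0)).Local v)), (1 : ((UnitaryGroup.cmDatum L 1 (Matrix.of fun i j : Fin 1 => if i.val + j.val + 1 = 1 then (1 : L) else 0)).Local v))), by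
    rw [hZH, Subgroup.mem_prod]; exact ⟨τ₂.2, Subgroup.one_mem _⟩⟩
  have hτH : ((τH : (((UnitaryGroup.cmDatum L 2 (Matrix.of fun i j : Fin 2 => if i.val + j.val + 1 = 2 then (1 : L) else 0)).Local v) ×
      ((UnitaryGroup.cmDatum L 1 (Matrix.of fun i j : Fin 1 => if i.val + j.val + 1 = 1 then (1 : L) else 0)).Local v)))) = ((τ₂ : ((UnitaryGroup.cmDatum L 2 (Matrix.of fun i j : Fin 2 => if i.val + j.val + 1 = 2 then (1 : L) else 0)).Local v)), (1 : ((UnitaryGroup.cmDatum L 1 (Matrix.of fun i j : Fin 1 => if i.val + j.val + 1 = 1 then (1 : L) else 0)).Local v))) := rfl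
  -- the product reading of `Z_H(δH)` and of its compact core
  let eZ : Subgroup.centralizer ({δH} : Set (((UnitaryGroup.cmDatum L 2 (Matrix.of fun i j : Fin 2 => if i.val + j.val + 1 = 2 then (1 : L) else 0)).Local v) ×
      ((UnitaryGroup.cmDatum L 1 (Matrix.of fun i j : Fin 1 => if i.val + j.val + 1 = 1 then (1 : L) else 0)).Local v))) ≃ₜ* Subgroup.centralizer ({δ} : Set ((UnitaryGroup.cmDatum L 2 (Matrix.of fun i j : Fin 2 => if i.val + j.val + 1 = 2 then (1 : L) else 0)).Local v)) × Subgroup.centralizer ({γH.2} : Set ((UnitaryGroup.cmDatum L 1 (Matrix.of fun i j : Fin 1 => if i.val + j.val + 1 = 1 then (1 : L) else 0)).Local v)) :=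
    { toFun := fun z => (⟨z.1.1, ((centralizer_prod_singleton δ γH.2).le z.2).1⟩, ⟨z.1.2, ((centralizer_prod_singleton δ γH.2).le z.2).2⟩)
      invFun := fun p => ⟨(p.1.1, p.2.1), (centralizer_prod_singleton δ γH.2).ge ⟨p.1.2, p.2.2⟩⟩
      left_inv := fun z => rfl
      right_inv := fun p => rfl
      map_mul' := fun z z' => rfl
      continuous_toFun := by
        refine Continuous.prodMk ?_ ?_
        · exact (continuous_fst.comp continuous_subtype_val).subtype_mk _
        · exact (continuous_snd.comp continuous_subtype_val).subtype_mk _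
      continuous_invFun := by
        exact ((continuous_subtype_val.comp continuous_fst).prodMk (continuous_subtype_val.comp continuous_snd)).subtype_mk _ }
  have himage : compactCore (Subgroup.centralizer ({δH} : Set (((UnitaryGroup.cmDatum L 2 (Matrix.of fun i j : Fin 2 => if i.val + j.val + 1 = 2 then (1 : L) else 0)).Local v) ×
      ((UnitaryGroup.cmDatum L 1 (Matrix.of fun i j : Fin 1 => if i.val + j.val + 1 = 1 then (1 : L) else 0)).Local v)))) =
      eZ ⁻¹' (compactCore (Subgroup.centralizer ({δ} : Set ((UnitaryGroup.cmDatum L 2 (Matrix.of fun i j : Fin 2 => if i.val + j.val + 1 = 2 then (1 : L) else 0)).Local v))) ×ˢ compactCore (Subgroup.centralizer ({γH.2} : Set ((UnitaryGroup.cmDatum L 1 (Matrix.of fun i j : Fin 1 => if i.val + j.val + 1 = 1 then (1 : L) else 0)).Local v)))) := by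
    rw [← compactCore_prod, ← image_compactCore eZ, eZ.injective.preimage_image]
  have heZτ : ∀ n : ℤ, eZ (τH ^ n) = (τ₂ ^ n, 1) := fun n => by
    rw [map_zpow]
    have h1 : eZ τH = (τ₂, 1) := Prod.ext (Subtype.ext rfl) (Subtype.ext rfl)
    rw [h1, Prod.pow_mk, _root_.one_zpow]
  -- `Z(γ_H.2) ≤ U(Φ₁)(L⁺_v)` is compact: its compact core is everything
  haveI : CompactSpace ((UnitaryGroup.cmDatum L 1 (Matrix.of fun i j : Fin 1 => if i.val + j.val + 1 = 1 then (1 : L) else 0)).Local v) :=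
    compactSpace_cmDatum_local_one_of_smul_eq L (Matrix.of fun i j : Fin 1 => if i.val + j.val + 1 = 1 then (1 : L) else 0) w hw (isUnit_placeForm_antidiagOne (E := L) 1 w.1)
  haveI : CompactSpace (Subgroup.centralizer ({γH.2} : Set ((UnitaryGroup.cmDatum L 1 (Matrix.of fun i j : Fin 1 => if i.val + j.val + 1 = 1 then (1 : L) else 0)).Local v))) := isCompact_iff_compactSpace.1 (isClosed_coe_centralizer_singleton γH.2).isCompact
  have hcc₁ : compactCore (Subgroup.centralizer ({γH.2} : Set ((UnitaryGroup.cmDatum L 1 (Matrix.of fun i j : Fin 1 => if i.val + j.val + 1 = 1 then (1 : L) else 0)).Local v))) = univ := compactCore_eq_univ _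
  have hgenH : ∀ c : Subgroup.centralizer ({δH} : Set (((UnitaryGroup.cmDatum L 2 (Matrix.of fun i j : Fin 2 => if i.val + j.val + 1 = 2 then (1 : L) else 0)).Local v) ×
      ((UnitaryGroup.cmDatum L 1 (Matrix.of fun i j : Fin 1 => if i.val + j.val + 1 = 1 then (1 : L) else 0)).Local v))), ∃ n : ℤ, c * (τH ^ n)⁻¹ ∈ compactCore (Subgroup.centralizer ({δH} : Set (((UnitaryGroup.cmDatum L 2 (Matrix.of fun i j : Fin 2 => if i.val + j.val + 1 = 2 then (1 : L) else 0)).Local v) ×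
      ((UnitaryGroup.cmDatum L 1 (Matrix.of fun i j : Fin 1 => if i.val + j.val + 1 = 1 then (1 : L) else 0)).Local v)))) := by
    intro c
    obtain ⟨n, hn⟩ := hgen₂ (eZ c).1
    refine ⟨n, ?_⟩
    rw [himage, mem_preimage, map_mul, map_inv, heZτ, mem_prod]
    refine ⟨?_, by rw [hcc₁]; exact mem_univ _⟩
    simpa only [Prod.fst_mul, Prod.fst_inv] using hn
  have hfreeH : ∀ n : ℤ, τH ^ n ∈ compactCore (Subgroup.centralizer ({δH} : Set (((UnitaryGroup.cmDatum L 2 (Matrix.of fun i j : Fin 2 => if i.val + j.val + 1 = 2 then (1 : L) else 0)).Local v) ×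
      ((UnitaryGroup.cmDatum L 1 (Matrix.of fun i j : Fin 1 => if i.val + j.val + 1 = 1 then (1 : L) else 0)).Local v)))) → n = 0 := by
    intro n hn
    rw [himage, mem_preimage, heZτ, mem_prod] at hn
    exact hfree₂ n hn.1
  -- the two per-period readings (★ (S4a))
  have hCst := F0P3cStCharTSEllMassHOrbEll.isCompact_isOpen_coe_prod_top L v hns C hCo hCc
  have hH' := classOrbitalIntegral_indicator_complex_eq_mul_natCard_quotient_zpowers (P := IsLocalGRegular L v) hPH hcanH hδH hcommH hcH hoH τH hgenH hfreeH
    (C.prod ⊤) hCst.2 hCst.1 hOH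
  have h₂' := classOrbitalIntegral_indicator_complex_eq_mul_natCard_quotient_zpowers
    (P := fun γ : ((UnitaryGroup.cmDatum L 2 (Matrix.of fun i j : Fin 2 => if i.val + j.val + 1 = 2 then (1 : L) else 0)).Local v) => IsRegularElt (γ.val : GL (Fin 2) (UnitaryGroup.LocalRing L v))) hP₂ hcan₂ hregδ hcomm₂ hc₂ ho₂ τ₂ hgen₂ hfree₂ C hCo hCc hO₂
  have hcount := natCard_quotient_orbitRel_zpowers_fixedBy_prod_top C δ γH.2 τ₂ τH hτH
  -- volume factors are non-zero
  have hvH : ((νHv ((C.prod ⊤ : Subgroup (((UnitaryGroup.cmDatum L 2 (Matrix.of fun i j : Fin 2 => if i.val + j.val + 1 = 2 then (1 : L) else 0)).Local v) ×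
      ((UnitaryGroup.cmDatum L 1 (Matrix.of fun i j : Fin 1 => if i.val + j.val + 1 = 1 then (1 : L) else 0)).Local v))))).toReal : ℂ) ≠ 0 :=
    Complex.ofReal_ne_zero.2 (ENNReal.toReal_pos (hCst.2.measure_pos νHv ⟨1, Subgroup.one_mem _⟩).ne' hCst.1.measure_lt_top.ne).ne'
  have hv₂ : ((ν₂ C).toReal : ℂ) ≠ 0 :=
    Complex.ofReal_ne_zero.2 (ENNReal.toReal_pos (hCo.measure_pos ν₂ ⟨1, C.one_mem⟩).ne' hCc.measure_lt_top.ne).ne'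
  -- pull the scalars out of the orbital integrals
  have hfunH : (fun g' : (((UnitaryGroup.cmDatum L 2 (Matrix.of fun i j : Fin 2 => if i.val + j.val + 1 = 2 then (1 : L) else 0)).Local v) ×
      ((UnitaryGroup.cmDatum L 1 (Matrix.of fun i j : Fin 1 => if i.val + j.val + 1 = 1 then (1 : L) else 0)).Local v)) => (((νHv ((C.prod ⊤ : Subgroup (((UnitaryGroup.cmDatum L 2 (Matrix.of fun i j : Fin 2 => if i.val + j.val + 1 = 2 then (1 : L) else 0)).Local v) ×
      ((UnitaryGroup.cmDatum L 1 (Matrix.of fun i j : Fin 1 => if i.val + j.val + 1 = 1 then (1 : L) else 0)).Local v))))).toReal : ℂ))⁻¹ * (((C.prod ⊤ : Subgroup (((UnitaryGroup.cmDatum L 2 (Matrix.of fun i j : Fin 2 => if i.val + j.val + 1 = 2 then (1 : L) else 0)).Local v) ×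
      ((UnitaryGroup.cmDatum L 1 (Matrix.of fun i j : Fin 1 => if i.val + j.val + 1 = 1 then (1 : L) else 0)).Local v)))) : Set (((UnitaryGroup.cmDatum L 2 (Matrix.of fun i j : Fin 2 => if i.val + j.val + 1 = 2 then (1 : L) else 0)).Local v) ×
      ((UnitaryGroup.cmDatum L 1 (Matrix.of fun i j : Fin 1 => if i.val + j.val + 1 = 1 then (1 : L) else 0)).Local v))).indicator (fun _ => (1 : ℂ)) g') =
      (((νHv ((C.prod ⊤ : Subgroup (((UnitaryGroup.cmDatum L 2 (Matrix.of fun i j : Fin 2 => if i.val + j.val + 1 = 2 then (1 : L) else 0)).Local v) ×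
      ((UnitaryGroup.cmDatum L 1 (Matrix.of fun i j : Fin 1 => if i.val + j.val + 1 = 1 then (1 : L) else 0)).Local v))))).toReal : ℂ))⁻¹ • (((C.prod ⊤ : Subgroup (((UnitaryGroup.cmDatum L 2 (Matrix.of fun i j : Fin 2 => if i.val + j.val + 1 = 2 then (1 : L) else 0)).Local v) ×
      ((UnitaryGroup.cmDatum L 1 (Matrix.of fun i j : Fin 1 => if i.val + j.val + 1 = 1 then (1 : L) else 0)).Local v)))) : Set (((UnitaryGroup.cmDatum L 2 (Matrix.of fun i j : Fin 2 => if i.val + j.val + 1 = 2 then (1 : L) else 0)).Local v) ×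
      ((UnitaryGroup.cmDatum L 1 (Matrix.of fun i j : Fin 1 => if i.val + j.val + 1 = 1 then (1 : L) else 0)).Local v))).indicator (fun _ => (1 : ℂ)) := by
    funext g'; rw [Pi.smul_apply, smul_eq_mul]
  have hfun₂ : (fun g' : ((UnitaryGroup.cmDatum L 2 (Matrix.of fun i j : Fin 2 => if i.val + j.val + 1 = 2 then (1 : L) else 0)).Local v) => (((ν₂ C).toReal : ℂ))⁻¹ * (C : Set ((UnitaryGroup.cmDatum L 2 (Matrix.of fun i j : Fin 2 => if i.val + j.val + 1 = 2 then (1 : L) else 0)).Local v)).indicator (fun _ => (1 : ℂ)) g') =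
      (((ν₂ C).toReal : ℂ))⁻¹ • (C : Set ((UnitaryGroup.cmDatum L 2 (Matrix.of fun i j : Fin 2 => if i.val + j.val + 1 = 2 then (1 : L) else 0)).Local v)).indicator (fun _ => (1 : ℂ)) := by
    funext g'; rw [Pi.smul_apply, smul_eq_mul]
  rw [hfunH, hfun₂, classOrbitalIntegral_eq, orbitalIntegral_smul, ← classOrbitalIntegral_eq, hH', classOrbitalIntegral_eq, orbitalIntegral_smul,
    ← classOrbitalIntegral_eq, h₂', smul_eq_mul, smul_eq_mul, ← mul_assoc, ← mul_assoc, inv_mul_cancel₀ hvH, inv_mul_cancel₀ hv₂, one_mul, one_mul]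
  exact_mod_cast hcount

/-- **AT EVERY `G`-REGULAR CLASS: `Φ_H(⟦γ_H⟧, νHv(C⋆)⁻¹ · 𝟙_{C⋆}; mHv) = Φ_{U₂}(⟦γ_H.1⟧, ν₂(C)⁻¹ · 𝟙_C; m₂)`** (compact centraliser: ★ (B2a); non-compact: the previous theorem) —
the `H`-side reading of every summand of Kottwitz's Euler–Poincaré function, for ANY Haar measures and canonical families on the two groups.
[cite: Kottwitz1988, §2 Theorem 2] [cite: Rogawski1990, §4.9 p. 54; §12.6 p. 187] [cite: Laumon1995, Lemma (5.3.2) p. 136] -/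
theorem classOrbitalIntegral_smul_indicator_prod_top_eq_U2_of_isLocalGRegular
    (hns : ∀ w : PlacesOver L v, IsCMField.complexConj L • w.1 = w.1)
    {mHv : OrbitalMeasureFamily (((UnitaryGroup.cmDatum L 2 (Matrix.of fun i j : Fin 2 => if i.val + j.val + 1 = 2 then (1 : L) else 0)).Local v) ×
      ((UnitaryGroup.cmDatum L 1 (Matrix.of fun i j : Fin 1 => if i.val + j.val + 1 = 1 then (1 : L) else 0)).Local v))} (hcanH : mHv.IsCanonical (IsLocalGRegular L v) νHv)
    {m₂ : OrbitalMeasureFamily ((UnitaryGroup.cmDatum L 2 (Matrix.of fun i j : Fin 2 => if i.val + j.val + 1 = 2 then (1 : L) else 0)).Local v)} (hcan₂ : m₂.IsCanonical (fun γ => IsRegularElt (γ.val : GL (Fin 2) (UnitaryGroup.LocalRing L v))) ν₂)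
    (C : Subgroup ((UnitaryGroup.cmDatum L 2 (Matrix.of fun i j : Fin 2 => if i.val + j.val + 1 = 2 then (1 : L) else 0)).Local v)) (hCo : IsOpen (C : Set ((UnitaryGroup.cmDatum L 2 (Matrix.of fun i j : Fin 2 => if i.val + j.val + 1 = 2 then (1 : L) else 0)).Local v))) (hCc : IsCompact (C : Set ((UnitaryGroup.cmDatum L 2 (Matrix.of fun i j : Fin 2 => if i.val + j.val + 1 = 2 then (1 : L) else 0)).Local v)))
    (γH : (((UnitaryGroup.cmDatum L 2 (Matrix.of fun i j : Fin 2 => if i.val + j.val + 1 = 2 then (1 : L) else 0)).Local v) ×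
      ((UnitaryGroup.cmDatum L 1 (Matrix.of fun i j : Fin 1 => if i.val + j.val + 1 = 1 then (1 : L) else 0)).Local v))) (hγ : IsLocalGRegular L v γH) :
    classOrbitalIntegral mHv
        (fun g => (((νHv ((C.prod ⊤ : Subgroup (((UnitaryGroup.cmDatum L 2 (Matrix.of fun i j : Fin 2 => if i.val + j.val + 1 = 2 then (1 : L) else 0)).Local v) ×
      ((UnitaryGroup.cmDatum L 1 (Matrix.of fun i j : Fin 1 => if i.val + j.val + 1 = 1 then (1 : L) else 0)).Local v))))).toReal : ℂ))⁻¹ * (((C.prod ⊤ : Subgroup (((UnitaryGroup.cmDatum L 2 (Matrix.of fun i j : Fin 2 => if i.val + j.val + 1 = 2 then (1 : L) else 0)).Local v) ×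
      ((UnitaryGroup.cmDatum L 1 (Matrix.of fun i j : Fin 1 => if i.val + j.val + 1 = 1 then (1 : L) else 0)).Local v)))) : Set _).indicator (fun _ => (1 : ℂ)) g)
        (ConjClasses.mk γH) =
      classOrbitalIntegral m₂ (fun g => (((ν₂ C).toReal : ℂ))⁻¹ * (C : Set ((UnitaryGroup.cmDatum L 2 (Matrix.of fun i j : Fin 2 => if i.val + j.val + 1 = 2 then (1 : L) else 0)).Local v)).indicator (fun _ => (1 : ℂ)) g) (ConjClasses.mk γH.1) := by
  by_cases hc : CompactSpace (Subgroup.centralizer ({γH.1} : Set ((UnitaryGroup.cmDatum L 2 (Matrix.of fun i j : Fin 2 => if i.val + j.val + 1 = 2 then (1 : L) else 0)).Local v)))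
  · exact F0P3cStCharTSEllMassHOrbEll.classOrbitalIntegral_smul_indicator_prod_top_eq_U2 L v νHv hns hcanH ν₂ hcan₂ C hCo hCc γH hγ
  · exact classOrbitalIntegral_smul_indicator_prod_top_eq_U2_of_not_compactSpace L v νHv ν₂ hns hcanH hcan₂ C hCo hCc γH hγ hc

end CM

end Summit.HodgeConjecture.HodgeConjecture.Cruxes.H413.F0P3cStCharTSEllMassHOrbSplit

end
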